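import Summits.NavierStokesRegularity.NavierStokesRegularity.Theorems.PeepholeVorticityDoorCoreDefs

/-!
# PeepholeVorticityDoorCoreLower — door S29 «PeepholeVorticityDoor», FILE 2: Stub B1 `CoreLowerS29` (the core integral is dominated by Tao's Carleman left-hand side)

Plate of record: nsreg-p1 g23 `r27/CoreLowerB1.lean` sha16 ac0d3d2fc67557d1 (farm rc 0 · 0 sorry; refuter1 g9 K-65 PASS: statement IDENTICAL to
`r27/Skeleton29.lean` a83afe48495060f1), re-based by ns-s29-p2 g2 on `PeepholeVorticityDoorCoreDefs` (the §1 quantities and the stub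
text `CoreLowerS29` are imported from there, local copies dropped; proof bodies untouched; DIRECTOR-NS #135 (b)).

Drop the gradient term, translate `x = x₀ + y` (Lebesgue measure is translation invariant), bound the Gaussian weight below by
`e^{−W}` on the core, and integrate in `s ∈ [t₀, 2t₀]`.  The two `ContinuousOn` hypotheses are LOAD-BEARING (integrability of the
larger integrand; continuity of `s ↦ ∫_{B(0,r/2)} h(s,y) dy` by dominated convergence).

Closes `theorem coreLowerS29_holds : CoreLowerS29` — one of the six hypotheses of `peepholeToCore_of_stubs`.
WHAT THIS IS NOT: not NS regularity; not `NoTypeII` (stmt-0056 OPEN); analytic bookkeeping for a HYPOTHETICAL-blow-up door.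
-/

noncomputable section

set_option linter.dupNamespace false

open MeasureTheory Set Filter Topology Metric Function
open scoped Topology ENNReal

namespace Summit.NavierStokesRegularity.NavierStokesRegularity.Theorems.PeepholeVorticityDoor

/-! ## helpers -/

/-- `B(0, r/2) ⊆ B̄(0, r)`. -/
theorem ball_half_subset_closedBall (r : ℝ) :
    ball (0 : EuclideanSpace ℝ (Fin 3)) (r / 2) ⊆ closedBall (0 : EuclideanSpace ℝ (Fin 3)) r := by
  intro y hy
  rw [mem_ball] at hy
  rw [mem_closedBall]
  linarith [dist_nonneg (x := y) (y := (0 : EuclideanSpace ℝ (Fin 3)))]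

/-- continuity of the Carleman integrand in `y` at a fixed time `s > 0`. -/
theorem continuousOn_integrand_slice {V : ℝ → EuclideanSpace ℝ (Fin 3) → EuclideanSpace ℝ (Fin 3)}
    {x₀ : EuclideanSpace ℝ (Fin 3)} {Tp r s : ℝ}
    (hUs : ContinuousOn (fun y => V s (x₀ + y)) (closedBall (0 : EuclideanSpace ℝ (Fin 3)) r))
    (hDUs : ContinuousOn (fun y => fderiv ℝ (fun y => V s (x₀ + y)) y) (closedBall (0 : EuclideanSpace ℝ (Fin 3)) r)) :
    ContinuousOn (fun y : EuclideanSpace ℝ (Fin 3) =>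
      (Tp⁻¹ * ‖V s (x₀ + y)‖ ^ 2 + ‖fderiv ℝ (fun y => V s (x₀ + y)) y‖ ^ 2) * Real.exp (-‖y‖ ^ 2 / (4 * s)))
      (closedBall (0 : EuclideanSpace ℝ (Fin 3)) r) := by
  have hw : Continuous fun y : EuclideanSpace ℝ (Fin 3) => Real.exp (-‖y‖ ^ 2 / (4 * s)) := by fun_prop
  exact ((continuousOn_const.mul (hUs.norm.pow 2)).add (hDUs.norm.pow 2)).mul hw.continuousOn

/-- **the slice inequality**: `T'⁻¹ e^{−W} ∫_{B(0,ρ)} |V(s,x)|² dx ≤ ∫_{B(0,r/2)} (T'⁻¹|U|² + |∇U|²) e^{−|y|²/4s} dy`. -/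
theorem slice_lower {V : ℝ → EuclideanSpace ℝ (Fin 3) → EuclideanSpace ℝ (Fin 3)} {x₀ : EuclideanSpace ℝ (Fin 3)}
    {ρ Tp r s W : ℝ} (hTp : 0 < Tp)
    (hUs : ContinuousOn (fun y => V s (x₀ + y)) (closedBall (0 : EuclideanSpace ℝ (Fin 3)) r))
    (hDUs : ContinuousOn (fun y => fderiv ℝ (fun y => V s (x₀ + y)) y) (closedBall (0 : EuclideanSpace ℝ (Fin 3)) r))
    (hsub : ball (0 : EuclideanSpace ℝ (Fin 3)) ρ ⊆ ball x₀ (r / 2))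
    (hW : ∀ x ∈ ball (0 : EuclideanSpace ℝ (Fin 3)) ρ, ‖x - x₀‖ ^ 2 / (4 * s) ≤ W) :
    Tp⁻¹ * Real.exp (-W) * ∫ x in ball (0 : EuclideanSpace ℝ (Fin 3)) ρ, ‖V s x‖ ^ 2 ≤
      ∫ y in ball (0 : EuclideanSpace ℝ (Fin 3)) (r / 2),
        (Tp⁻¹ * ‖V s (x₀ + y)‖ ^ 2 + ‖fderiv ℝ (fun y => V s (x₀ + y)) y‖ ^ 2) * Real.exp (-‖y‖ ^ 2 / (4 * s)) := by
  set A : Set (EuclideanSpace ℝ (Fin 3)) := (fun y => x₀ + y) ⁻¹' ball (0 : EuclideanSpace ℝ (Fin 3)) ρ with hAdef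
  have hAmeas : MeasurableSet A := measurableSet_ball.preimage (measurable_const_add x₀)
  have hAsub : A ⊆ ball (0 : EuclideanSpace ℝ (Fin 3)) (r / 2) := by
    intro y hy
    have h1 : x₀ + y ∈ ball x₀ (r / 2) := hsub hy
    rw [mem_ball, dist_eq_norm, add_sub_cancel_left] at h1
    exact mem_ball_zero_iff.2 h1
  -- the two integrands on `B(0, r/2)`
  have hfc := continuousOn_integrand_slice (Tp := Tp) (s := s) hUs hDUs
  have hf_int : IntegrableOn (fun y : EuclideanSpace ℝ (Fin 3) =>
      (Tp⁻¹ * ‖V s (x₀ + y)‖ ^ 2 + ‖fderiv ℝ (fun y => V s (x₀ + y)) y‖ ^ 2) * Real.exp (-‖y‖ ^ 2 / (4 * s)))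
      (ball (0 : EuclideanSpace ℝ (Fin 3)) (r / 2)) :=
    (hfc.integrableOn_compact (isCompact_closedBall _ _)).mono_set (ball_half_subset_closedBall r)
  have hw : Continuous fun y : EuclideanSpace ℝ (Fin 3) => Real.exp (-‖y‖ ^ 2 / (4 * s)) := by fun_prop
  have hf₁c : ContinuousOn (fun y : EuclideanSpace ℝ (Fin 3) => Tp⁻¹ * ‖V s (x₀ + y)‖ ^ 2 * Real.exp (-‖y‖ ^ 2 / (4 * s)))
      (closedBall (0 : EuclideanSpace ℝ (Fin 3)) r) :=
    (continuousOn_const.mul (hUs.norm.pow 2)).mul hw.continuousOn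
  have hf₁_int : IntegrableOn (fun y : EuclideanSpace ℝ (Fin 3) => Tp⁻¹ * ‖V s (x₀ + y)‖ ^ 2 * Real.exp (-‖y‖ ^ 2 / (4 * s)))
      (ball (0 : EuclideanSpace ℝ (Fin 3)) (r / 2)) :=
    (hf₁c.integrableOn_compact (isCompact_closedBall _ _)).mono_set (ball_half_subset_closedBall r)
  -- (d) translation
  have htrans : ∫ y in A, ‖V s (x₀ + y)‖ ^ 2 = ∫ x in ball (0 : EuclideanSpace ℝ (Fin 3)) ρ, ‖V s x‖ ^ 2 :=
    (measurePreserving_add_left volume x₀).setIntegral_preimage_emb (measurableEmbedding_addLeft x₀)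
      (fun x => ‖V s x‖ ^ 2) (ball (0 : EuclideanSpace ℝ (Fin 3)) ρ)
  -- (c) the weight on the core
  have hc : ∫ y in A, Tp⁻¹ * Real.exp (-W) * ‖V s (x₀ + y)‖ ^ 2 ≤
      ∫ y in A, Tp⁻¹ * ‖V s (x₀ + y)‖ ^ 2 * Real.exp (-‖y‖ ^ 2 / (4 * s)) := by
    refine integral_mono_of_nonneg (Eventually.of_forall fun y => by positivity) (hf₁_int.mono_set hAsub) ?_
    refine (ae_restrict_iff' hAmeas).2 (Eventually.of_forall fun y hy => ?_)
    have hyW : ‖y‖ ^ 2 / (4 * s) ≤ W := by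
      have := hW (x₀ + y) hy
      rwa [add_sub_cancel_left] at this
    have hexp : Real.exp (-W) ≤ Real.exp (-‖y‖ ^ 2 / (4 * s)) := by
      apply Real.exp_le_exp.2; rw [neg_div]; linarith
    calc Tp⁻¹ * Real.exp (-W) * ‖V s (x₀ + y)‖ ^ 2 = Tp⁻¹ * ‖V s (x₀ + y)‖ ^ 2 * Real.exp (-W) := by ring
      _ ≤ Tp⁻¹ * ‖V s (x₀ + y)‖ ^ 2 * Real.exp (-‖y‖ ^ 2 / (4 * s)) :=
          mul_le_mul_of_nonneg_left hexp (by positivity)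
  -- (b) enlarge the domain
  have hb : ∫ y in A, Tp⁻¹ * ‖V s (x₀ + y)‖ ^ 2 * Real.exp (-‖y‖ ^ 2 / (4 * s)) ≤
      ∫ y in ball (0 : EuclideanSpace ℝ (Fin 3)) (r / 2), Tp⁻¹ * ‖V s (x₀ + y)‖ ^ 2 * Real.exp (-‖y‖ ^ 2 / (4 * s)) :=
    setIntegral_mono_set hf₁_int (Eventually.of_forall fun y => by positivity) hAsub.eventuallyLE
  -- (a) drop the gradient term
  have ha : ∫ y in ball (0 : EuclideanSpace ℝ (Fin 3)) (r / 2), Tp⁻¹ * ‖V s (x₀ + y)‖ ^ 2 * Real.exp (-‖y‖ ^ 2 / (4 * s)) ≤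
      ∫ y in ball (0 : EuclideanSpace ℝ (Fin 3)) (r / 2),
        (Tp⁻¹ * ‖V s (x₀ + y)‖ ^ 2 + ‖fderiv ℝ (fun y => V s (x₀ + y)) y‖ ^ 2) * Real.exp (-‖y‖ ^ 2 / (4 * s)) := by
    refine integral_mono_of_nonneg (Eventually.of_forall fun y => by positivity) hf_int
      (Eventually.of_forall fun y => ?_)
    have h0 : 0 ≤ ‖fderiv ℝ (fun y => V s (x₀ + y)) y‖ ^ 2 * Real.exp (-‖y‖ ^ 2 / (4 * s)) := by positivity
    nlinarith [h0]
  rw [← htrans, ← integral_const_mul]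
  exact hc.trans (hb.trans ha)

/-- continuity of `s ↦ ∫_{B(0,r/2)} h(s,y) dy` on `[t₀, 2t₀]` (dominated convergence on a finite-measure ball). -/
theorem continuousOn_carlemanIntegral {V : ℝ → EuclideanSpace ℝ (Fin 3) → EuclideanSpace ℝ (Fin 3)}
    {x₀ : EuclideanSpace ℝ (Fin 3)} {Tp r t₀ : ℝ} (ht₀ : 0 < t₀) (h2t₀ : 2 * t₀ ≤ Tp)
    (hcU : ContinuousOn (uncurry fun s y => V s (x₀ + y)) (Icc 0 Tp ×ˢ closedBall (0 : EuclideanSpace ℝ (Fin 3)) r))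
    (hcDU : ContinuousOn (fun z : ℝ × EuclideanSpace ℝ (Fin 3) => fderiv ℝ (fun y => V z.1 (x₀ + y)) z.2)
      (Icc 0 Tp ×ˢ closedBall (0 : EuclideanSpace ℝ (Fin 3)) r)) :
    ContinuousOn (fun s => ∫ y in ball (0 : EuclideanSpace ℝ (Fin 3)) (r / 2),
      (Tp⁻¹ * ‖V s (x₀ + y)‖ ^ 2 + ‖fderiv ℝ (fun y => V s (x₀ + y)) y‖ ^ 2) * Real.exp (-‖y‖ ^ 2 / (4 * s)))
      (Icc t₀ (2 * t₀)) := by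
  have hK : IsCompact (Icc (0 : ℝ) Tp ×ˢ closedBall (0 : EuclideanSpace ℝ (Fin 3)) r) :=
    isCompact_Icc.prod (isCompact_closedBall _ _)
  obtain ⟨C₁, hC₁⟩ := hK.exists_bound_of_continuousOn hcU
  obtain ⟨C₂, hC₂⟩ := hK.exists_bound_of_continuousOn hcDU
  have hIcc : ∀ s ∈ Icc t₀ (2 * t₀), s ∈ Icc (0 : ℝ) Tp := fun s hs => ⟨by linarith [hs.1], by linarith [hs.2]⟩
  -- slices in `y`
  have hUs : ∀ s ∈ Icc (0 : ℝ) Tp, ContinuousOn (fun y => V s (x₀ + y)) (closedBall (0 : EuclideanSpace ℝ (Fin 3)) r) := by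
    intro s hs
    have hι : Continuous fun y : EuclideanSpace ℝ (Fin 3) => (s, y) := by fun_prop
    exact hcU.comp hι.continuousOn fun y hy => ⟨hs, hy⟩
  have hDUs : ∀ s ∈ Icc (0 : ℝ) Tp, ContinuousOn (fun y => fderiv ℝ (fun y => V s (x₀ + y)) y)
      (closedBall (0 : EuclideanSpace ℝ (Fin 3)) r) := by
    intro s hs
    have hι : Continuous fun y : EuclideanSpace ℝ (Fin 3) => (s, y) := by fun_prop
    exact hcDU.comp hι.continuousOn fun y hy => ⟨hs, hy⟩
  refine continuousOn_of_dominated (μ := volume.restrict (ball (0 : EuclideanSpace ℝ (Fin 3)) (r / 2)))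
    (bound := fun _ => Tp⁻¹ * C₁ ^ 2 + C₂ ^ 2) ?_ ?_ ?_ ?_
  · intro s hs
    exact ((continuousOn_integrand_slice (Tp := Tp) (hUs s (hIcc s hs)) (hDUs s (hIcc s hs))).mono
      (ball_half_subset_closedBall r)).aestronglyMeasurable measurableSet_ball
  · intro s hs
    refine (ae_restrict_iff' measurableSet_ball).2 (Eventually.of_forall fun y hy => ?_)
    have hy' : y ∈ closedBall (0 : EuclideanSpace ℝ (Fin 3)) r := ball_half_subset_closedBall r hy
    have h1 : ‖V s (x₀ + y)‖ ≤ C₁ := hC₁ (s, y) ⟨hIcc s hs, hy'⟩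
    have h2 : ‖fderiv ℝ (fun y => V s (x₀ + y)) y‖ ≤ C₂ := hC₂ (s, y) ⟨hIcc s hs, hy'⟩
    have h1' : ‖V s (x₀ + y)‖ ^ 2 ≤ C₁ ^ 2 := pow_le_pow_left₀ (norm_nonneg _) h1 2
    have h2' : ‖fderiv ℝ (fun y => V s (x₀ + y)) y‖ ^ 2 ≤ C₂ ^ 2 := pow_le_pow_left₀ (norm_nonneg _) h2 2
    have hs0 : 0 < s := by linarith [hs.1]
    have hw1 : Real.exp (-‖y‖ ^ 2 / (4 * s)) ≤ 1 := by
      rw [Real.exp_le_one_iff, neg_div]; exact neg_nonpos.2 (by positivity)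
    have hw0 : 0 ≤ Real.exp (-‖y‖ ^ 2 / (4 * s)) := (Real.exp_pos _).le
    have hTi : 0 ≤ Tp⁻¹ := inv_nonneg.2 (by linarith)
    rw [Real.norm_of_nonneg (by positivity)]
    calc (Tp⁻¹ * ‖V s (x₀ + y)‖ ^ 2 + ‖fderiv ℝ (fun y => V s (x₀ + y)) y‖ ^ 2) * Real.exp (-‖y‖ ^ 2 / (4 * s))
        ≤ (Tp⁻¹ * C₁ ^ 2 + C₂ ^ 2) * Real.exp (-‖y‖ ^ 2 / (4 * s)) := by
          apply mul_le_mul_of_nonneg_right _ hw0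
          nlinarith [mul_le_mul_of_nonneg_left h1' hTi]
      _ ≤ (Tp⁻¹ * C₁ ^ 2 + C₂ ^ 2) * 1 := by
          apply mul_le_mul_of_nonneg_left hw1
          nlinarith [mul_le_mul_of_nonneg_left h1' hTi, sq_nonneg ‖V s (x₀ + y)‖]
      _ = Tp⁻¹ * C₁ ^ 2 + C₂ ^ 2 := mul_one _
  · exact integrableOn_const measure_ball_lt_top.ne
  · refine (ae_restrict_iff' measurableSet_ball).2 (Eventually.of_forall fun y hy => ?_)
    have hy' : y ∈ closedBall (0 : EuclideanSpace ℝ (Fin 3)) r := ball_half_subset_closedBall r hy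
    have hι : Continuous fun s : ℝ => (s, y) := by fun_prop
    have hV : ContinuousOn (fun s => V s (x₀ + y)) (Icc t₀ (2 * t₀)) :=
      hcU.comp hι.continuousOn fun s hs => ⟨hIcc s hs, hy'⟩
    have hDV : ContinuousOn (fun s => fderiv ℝ (fun y => V s (x₀ + y)) y) (Icc t₀ (2 * t₀)) :=
      hcDU.comp hι.continuousOn fun s hs => ⟨hIcc s hs, hy'⟩
    have hwt : ContinuousOn (fun s : ℝ => Real.exp (-‖y‖ ^ 2 / (4 * s))) (Icc t₀ (2 * t₀)) := by
      apply ContinuousOn.rexp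
      apply ContinuousOn.div continuousOn_const (by fun_prop)
      intro s hs; have : 0 < s := by linarith [hs.1]
      positivity
    exact ((continuousOn_const.mul (hV.norm.pow 2)).add (hDV.norm.pow 2)).mul hwt

/-! ## Stub B1 -/

/-- **Stub B1** `CoreLowerS29` holds. -/
theorem coreLowerS29_holds : CoreLowerS29 := by
  intro V x₀ ρ Tp r t₀ W hTp ht₀ h2t₀ hcU hcDU hsub hW
  have hle2 : t₀ ≤ 2 * t₀ := by linarith
  have hIcc : ∀ s ∈ Icc t₀ (2 * t₀), s ∈ Icc (0 : ℝ) Tp := fun s hs => ⟨by linarith [hs.1], by linarith [hs.2]⟩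
  have hper : ∀ s ∈ Icc t₀ (2 * t₀),
      Tp⁻¹ * Real.exp (-W) * ∫ x in ball (0 : EuclideanSpace ℝ (Fin 3)) ρ, ‖V s x‖ ^ 2 ≤
        ∫ y in ball (0 : EuclideanSpace ℝ (Fin 3)) (r / 2),
          (Tp⁻¹ * ‖V s (x₀ + y)‖ ^ 2 + ‖fderiv ℝ (fun y => V s (x₀ + y)) y‖ ^ 2) * Real.exp (-‖y‖ ^ 2 / (4 * s)) := by
    intro s hs
    have hι : Continuous fun y : EuclideanSpace ℝ (Fin 3) => (s, y) := by fun_prop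
    exact slice_lower hTp (hcU.comp hι.continuousOn fun y hy => ⟨hIcc s hs, hy⟩)
      (hcDU.comp hι.continuousOn fun y hy => ⟨hIcc s hs, hy⟩) hsub (fun x hx => hW s hs x hx)
  have hG := continuousOn_carlemanIntegral (r := r) ht₀ h2t₀ hcU hcDU
  show Tp⁻¹ * Real.exp (-W) * (∫ s in t₀..2 * t₀, ∫ x in ball (0 : EuclideanSpace ℝ (Fin 3)) ρ, ‖V s x‖ ^ 2) ≤
    ∫ s in t₀..2 * t₀, ∫ y in ball (0 : EuclideanSpace ℝ (Fin 3)) (r / 2),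
      (Tp⁻¹ * ‖V s (x₀ + y)‖ ^ 2 + ‖fderiv ℝ (fun y => V s (x₀ + y)) y‖ ^ 2) * Real.exp (-‖y‖ ^ 2 / (4 * s))
  rw [← intervalIntegral.integral_const_mul, intervalIntegral.integral_of_le hle2, intervalIntegral.integral_of_le hle2]
  refine integral_mono_of_nonneg ?_ ((hG.integrableOn_compact isCompact_Icc).mono_set Ioc_subset_Icc_self) ?_
  · exact Eventually.of_forall fun s =>
      mul_nonneg (mul_nonneg (inv_nonneg.2 hTp.le) (Real.exp_pos _).le) (integral_nonneg fun x => by positivity)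
  · exact (ae_restrict_iff' measurableSet_Ioc).2 (Eventually.of_forall fun s hs => hper s (Ioc_subset_Icc_self hs))

end Summit.NavierStokesRegularity.NavierStokesRegularity.Theorems.PeepholeVorticityDoor

end
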